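import Mathlib
import Summits.ResolutionOfSingularities.ResolutionOfSingularities.Theorems.HomologicalConductorPersistenceAddCoverFamily
import Summits.ResolutionOfSingularities.ResolutionOfSingularities.Theorems.HomologicalConductorPersistenceSurfaceCompleteHerzogTransfer
import Literature.RingTheory.CohomologyAnnihilator.SyzygyBaseChange
import Literature.RingTheory.CohomologyAnnihilator.TowerRestrict
import HarnessLib

/-!
# Rung S-2 `PersistenceSurface` (stmt-ResolutionOfSingularities-19970), stub C1 (`Sat₄`) — the `Sat₄` SUMMAND DATA
# BASE-CHANGES along a flat algebra, and the certificate over the extension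

[OURS · cell decomp-res · rung S-2; seat leafhand-res-homologicalconduct-15 gen 0]  Nothing here is a statement of the
manuscript under review (Hironaka 2017); AI-written, weaker than expert review.  DEF-FREE.

The abstract `Sat₄` certificate `…PersistenceAddCoverFamily.cohomologyAnnihilatorOfDegree_eq_of_summandData` takes, over
a noetherian `T`: a cover `hcov` of the `n`-th syzygies by `add V`, a splitting `e : V ≅ Π_a M_a`, first syzygies
`K_a` of the pieces, a family `ψ` of test pieces with `K_a ∈ add ((Π_t M_{ψ t}) × T)` (Wunram's law) and every test
piece a retract of some `K_{ψ s}` (Ω-stability).  This file shows that ALL the data except `hcov` base-change along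
any FLAT `T`-algebra `T'` (`M_a ↦ T' ⊗ M_a`, `K_a ↦ T' ⊗ K_a`), and packages the certificate over `T'` with the cover
`hcov'` supplied there (for `T' = Ŝ` the cover is `…CompleteHerzogTransfer` ∘ `…LocalHerzogTransfer` ∘ graded
Herzog).  Brick (v) of the level-exact completion transport of the toric `Sat₄` theorem (HAND15-TRANSPORT §3); what
remains for the toric class is to EXPOSE the summand data of `cohomologyAnnihilator_cyclicQuotient_of_chain_charFree`
(today internal to its proof) and to discharge the completion-like hypotheses for `U_𝔪 → (U_𝔪)^`.

* `isSyzygy_one_baseChange`, `isRetractOfPower_testProduct_baseChange`, `retract_baseChange` — the three data items;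
* `piIso_baseChange` — `T' ⊗ V ≅ Π_a (T' ⊗ M_a)`;
* `cohomologyAnnihilatorOfDegree_eq_of_summandData_baseChange` — **`caᵐ(T') = caⁿ⁺²(T')` (`m ≥ n + 2`) from summand
  data over `T` and an `add (T' ⊗ V)`-cover of the `n`-th syzygies over `T'`.**

References: S. B. Iyengar, R. Takahashi, IMRN 2016, Def. 4.1 [`IyengarTakahashi2014`] (vocabulary) — tree lemmas only.
-/

-- single-problem summit: the doubled namespace component `ResolutionOfSingularities` is forced
set_option linter.dupNamespace false

noncomputable section

open CategoryTheory TensorProduct Literature.RingTheory.CohomologyAnnihilator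
open Summit.ResolutionOfSingularities.ResolutionOfSingularities.Theorems.HomologicalConductor.PersistenceAddCoverFamily
open Summit.ResolutionOfSingularities.ResolutionOfSingularities.Theorems.HomologicalConductor.PersistenceSurfaceCompleteHerzogTransfer
  (isRetractOfPower_baseChange)

universe u

namespace Summit.ResolutionOfSingularities.ResolutionOfSingularities.Theorems.HomologicalConductor.PersistenceSummandDataBaseChange

variable {T : Type u} [CommRing T] (T' : Type u) [CommRing T'] [Algebra T T']
variable {ι κ : Type} [Fintype ι] [Fintype κ] [DecidableEq ι] [DecidableEq κ]

/-- A retraction `i ≫ r = 𝟙` base-changes to a retraction. [folklore] -/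
theorem retract_baseChange {X Y : ModuleCat.{u} T} (i : X ⟶ Y) (r : Y ⟶ X) (h : i ≫ r = 𝟙 X) :
    ModuleCat.ofHom (X := ModuleCat.of T' (T' ⊗[T] X)) (Y := ModuleCat.of T' (T' ⊗[T] Y)) (i.hom.baseChange T') ≫
      ModuleCat.ofHom (X := ModuleCat.of T' (T' ⊗[T] Y)) (Y := ModuleCat.of T' (T' ⊗[T] X)) (r.hom.baseChange T') =
        𝟙 (ModuleCat.of T' (T' ⊗[T] X)) := by
  have hri : r.hom ∘ₗ i.hom = LinearMap.id := by
    have h' := congrArg ModuleCat.Hom.hom h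
    rwa [ModuleCat.hom_comp, ModuleCat.hom_id] at h'
  apply ModuleCat.hom_ext
  rw [ModuleCat.hom_comp, ModuleCat.hom_ofHom, ModuleCat.hom_ofHom, ModuleCat.hom_id, ← LinearMap.baseChange_comp,
    hri, LinearMap.baseChange_id]

omit [Fintype ι] [Fintype κ] [DecidableEq ι] [DecidableEq κ] in
/-- **Ω-stability base-changes**: the test-piece retracts `M_{ψ t} ⇄ K_{ψ s}` base-change. [folklore] -/
theorem omegaStable_baseChange (M K : ι → ModuleCat.{u} T) (ψ : κ → ι)
    (hD : ∀ t, ∃ (s : κ) (i : M (ψ t) ⟶ K (ψ s)) (r : K (ψ s) ⟶ M (ψ t)), i ≫ r = 𝟙 (M (ψ t))) :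
    ∀ t, ∃ (s : κ) (i : ModuleCat.of T' (T' ⊗[T] M (ψ t)) ⟶ ModuleCat.of T' (T' ⊗[T] K (ψ s)))
      (r : ModuleCat.of T' (T' ⊗[T] K (ψ s)) ⟶ ModuleCat.of T' (T' ⊗[T] M (ψ t))),
      i ≫ r = 𝟙 (ModuleCat.of T' (T' ⊗[T] M (ψ t))) := by
  intro t
  obtain ⟨s, i, r, h⟩ := hD t
  exact ⟨s, _, _, retract_baseChange T' i r h⟩

omit [Fintype ι] [DecidableEq ι] in
/-- **First syzygies base-change** along a flat algebra. [cite: IyengarTakahashi2014, Thm. 5.4 (proof)] -/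
theorem isSyzygy_one_baseChange [Module.Flat T T'] (M K : ι → ModuleCat.{u} T) (hK : ∀ a, IsSyzygy 1 (M a) (K a)) :
    ∀ a, IsSyzygy 1 (ModuleCat.of T' (T' ⊗[T] M a)) (ModuleCat.of T' (T' ⊗[T] K a)) :=
  fun a => IsSyzygy.baseChange T' 1 (hK a)

omit [Fintype ι] [DecidableEq ι] in
/-- **Wunram's law base-changes**: `K_a ∈ add ((Π_t M_{ψ t}) × T)` over `T` gives
`T' ⊗ K_a ∈ add ((Π_t T' ⊗ M_{ψ t}) × T')` over `T'` (`⊗` commutes with finite products, `T' ⊗ T ≅ T'`). [folklore] -/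
theorem isRetractOfPower_testProduct_baseChange (M K : ι → ModuleCat.{u} T) (ψ : κ → ι)
    (hKD : ∀ a, IsRetractOfPower (ModuleCat.of T ((Π t, M (ψ t)) × T)) (K a)) :
    ∀ a, IsRetractOfPower (ModuleCat.of T' ((Π t, T' ⊗[T] M (ψ t)) × T')) (ModuleCat.of T' (T' ⊗[T] K a)) := by
  intro a
  have h := isRetractOfPower_baseChange T' (hKD a)
  -- change the generator along `T' ⊗ ((Π_t M_{ψ t}) × T) ≅ (Π_t T' ⊗ M_{ψ t}) × T'`
  let eG : T' ⊗[T] ((Π t, M (ψ t)) × T) ≃ₗ[T'] ((Π t, T' ⊗[T] M (ψ t)) × T') :=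
    TensorProduct.prodRight T T' T' (Π t, M (ψ t)) T ≪≫ₗ
      LinearEquiv.prodCongr (TensorProduct.piRight T T' T' (fun t => (M (ψ t) : Type u)))
        (AlgebraTensorModule.rid T T' T')
  exact ((isRetractOfPower_self _).of_iso eG.symm.toModuleIso).of_isRetractOfPower_gen h

/-- **The splitting base-changes**: `T' ⊗ V ≅ Π_a (T' ⊗ M_a)`. [folklore] -/
theorem piIso_baseChange {V : ModuleCat.{u} T} (M : ι → ModuleCat.{u} T) (e : V ≅ ModuleCat.of T (Π a, M a)) :
    Nonempty (ModuleCat.of T' (T' ⊗[T] V) ≅ ModuleCat.of T' (Π a, T' ⊗[T] M a)) :=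
  ⟨(LinearEquiv.baseChange T T' _ _ e.toLinearEquiv ≪≫ₗ
      TensorProduct.piRight T T' T' (fun a => (M a : Type u))).toModuleIso⟩

/-- **THE CERTIFICATE OVER A FLAT EXTENSION.**  Summand data over the noetherian `T` (splitting `e`, first syzygies
`hK`, Wunram's law `hKD`, Ω-stability `hD`, finitely generated test pieces) and, over the flat noetherian `T`-algebra
`T'`, an `add (T' ⊗ V)`-cover of the `n`-th syzygies ⇒ `caᵐ(T') = caⁿ⁺²(T')` for every `m ≥ n + 2` (and
`ca(T') = caⁿ⁺²(T')`). [OURS · cell decomp-res] -/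
theorem cohomologyAnnihilatorOfDegree_eq_of_summandData_baseChange [IsNoetherianRing T'] [Module.Flat T T']
    {V : ModuleCat.{u} T} (n : ℕ)
    (hcov' : ∀ (N L : ModuleCat.{u} T'), Module.Finite T' N → IsSyzygy n N L →
      IsRetractOfPower (ModuleCat.of T' (T' ⊗[T] V)) L)
    (M K : ι → ModuleCat.{u} T) (e : V ≅ ModuleCat.of T (Π a, M a)) (hK : ∀ a, IsSyzygy 1 (M a) (K a))
    (ψ : κ → ι) [∀ t, Module.Finite T (M (ψ t))]
    (hKD : ∀ a, IsRetractOfPower (ModuleCat.of T ((Π t, M (ψ t)) × T)) (K a))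
    (hD : ∀ t, ∃ (s : κ) (i : M (ψ t) ⟶ K (ψ s)) (r : K (ψ s) ⟶ M (ψ t)), i ≫ r = 𝟙 (M (ψ t))) :
    (∀ m : ℕ, n + 2 ≤ m → cohomologyAnnihilatorOfDegree T' m = cohomologyAnnihilatorOfDegree T' (n + 2)) ∧
      cohomologyAnnihilator T' = cohomologyAnnihilatorOfDegree T' (n + 2) := by
  obtain ⟨e'⟩ := piIso_baseChange T' M e
  let M' : ι → ModuleCat.{u} T' := fun a => ModuleCat.of T' (T' ⊗[T] M a)
  let K' : ι → ModuleCat.{u} T' := fun a => ModuleCat.of T' (T' ⊗[T] K a)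
  haveI : ∀ t, Module.Finite T' (M' (ψ t)) := fun t => Module.Finite.base_change T T' (M (ψ t))
  have hK' : ∀ a, IsSyzygy 1 (M' a) (K' a) := isSyzygy_one_baseChange T' M K hK
  have hKD' : ∀ a, IsRetractOfPower (ModuleCat.of T' ((Π t, M' (ψ t)) × T')) (K' a) :=
    isRetractOfPower_testProduct_baseChange T' M K ψ hKD
  have hD' : ∀ t, ∃ (s : κ) (i : M' (ψ t) ⟶ K' (ψ s)) (r : K' (ψ s) ⟶ M' (ψ t)), i ≫ r = 𝟙 (M' (ψ t)) :=
    omegaStable_baseChange T' M K ψ hD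
  exact ⟨fun m hm => cohomologyAnnihilatorOfDegree_eq_of_summandData n hcov' M' K' e' hK' ψ hKD' hD' hm,
    cohomologyAnnihilator_eq_of_summandData n hcov' M' K' e' hK' ψ hKD' hD'⟩

end Summit.ResolutionOfSingularities.ResolutionOfSingularities.Theorems.HomologicalConductor.PersistenceSummandDataBaseChange

end
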